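import Mathlib
import Literature.NumberTheory.Automorphic.FuchsianCompactCore

/-!
# The invariant height `y_Γ(z)` of a finite volume Fuchsian group
(Iwaniec, *Spectral Methods of Automorphic Forms*, GSM 53, §2.6 (2.42)–(2.43) and §2.2 (2.3)–(2.5),
PDF pp. 30–31, 39–40)

Seventh brick of the theory of a GENERAL discrete `Γ ≤ SL₂(ℝ)`: for a complete system of
inequivalent cusps `𝔞_i = σ_i∞` with `σ_i⁻¹Γ_{𝔞_i}σ_i = {±Tⁿ}` (`FuchsianCuspZones.exists_cuspSystem`)
Iwaniec's **invariant height** (2.42)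

  `y_Γ(z) = max_i max_{γ ∈ Γ} Im σ_i⁻¹γz`,

the tool that makes estimates "uniform as `z` runs to infinity through cuspidal zones". This file
defines it (`invHeight`, a supremum; `0` when there is no cusp) and PROVES: the maximum is attained
and finite (`exists_isGreatest_heightSet`, from Lemma 2.10's finiteness in each frame), `Γ`-invariance
(`invHeight_smul`), **`y_Γ(σ_i w) = Im w` for `Im w ≥ 1`** (`invHeight_frame_smul`: inside a cuspidal
zone the invariant height is the frame height — the precise invariance of the horoballs), the
positive lower bound (2.43) **`y_Γ = min_z y_Γ(z) > 0`** (`exists_pos_le_invHeight`, from the compact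
core of `FuchsianCompactCore`), and the partition of `Γ\ℍ` by height: a point with `y_Γ(z) > Y` is
`Γ`-equivalent to a point of a cuspidal zone `σ_i P(Y)` (`exists_smul_mem_cuspStrip_of_lt`), and the
points with `y_Γ(z) ≤ Y` are `Γ`-equivalent to points of a fixed compact set
(`exists_compact_of_invHeight_le`, (2.5): `F(Y)` has compact closure). Everything is proved;
nothing is vendored; no fact is introduced.

## References
* [Iwaniec2002] H. Iwaniec, *Spectral Methods of Automorphic Forms*, 2nd ed., GSM 53, AMS 2002,
  §2.2 (2.3)–(2.5), §2.6 (2.42)–(2.43), PDF pp. 30–31, 39–40.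

Mathlib: `sSup`/`IsGreatest.csSup_eq`/`le_csSup`, `Subgroup.strictPeriods`,
`Subgroup.conjAct_pointwise_smul_eq_self`, `IsCompact.exists_isMinOn`. Literature:
`exists_smul_maximal`, `exists_forall_rowIm_le`, `im_smul_eq_rowIm`, `row_mem_rows`,
`IsDiscreteSubgroup.conj`, `conj_le_range`, `mem_conj_inv_iff`, `conj_inv_mul` (`FuchsianGroupCusps`);
`upperRightHom_one_mem_of_periods`, `conj_eq_upperRightHom_of_smul_eq`, `one_le_abs_c_of_ne`,
`im_smul_mul_im_le_one`, `upperRightHom_smul`, `cuspStrip` (`FuchsianCuspZones`);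
`exists_compact_core` (`FuchsianCompactCore`). Nothing on the invariant height existed
(`lean search 'invariant height|invHeight|y_Γ'`).
-/

noncomputable section

namespace Literature.NumberTheory.Automorphic

namespace Fuchsian

open Matrix UpperHalfPlane _root_.MeasureTheory _root_.Set
open scoped _root_.MatrixGroups _root_.Pointwise _root_.ENNReal _root_.NNReal _root_.Real

variable {Γ : Subgroup (GL (Fin 2) ℝ)} {F : Set ℍ} {h : ℕ} {𝔞 : Fin h → OnePoint ℝ} {σ : Fin h → SL(2, ℝ)}

/-! ## 1. The height set and the invariant height -/

section Defs

/-- The heights `Im σ_i⁻¹ γ z`, `i` a cusp index, `γ ∈ Γ`. [cite: Iwaniec2002, §2.6 (2.42), PDF p. 39] -/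
def heightSet (Γ : Subgroup (GL (Fin 2) ℝ)) (σ : Fin h → SL(2, ℝ)) (z : ℍ) : Set ℝ :=
  {y | ∃ i, ∃ γ ∈ Γ, ((Matrix.SpecialLinearGroup.toGL (σ i) : GL (Fin 2) ℝ)⁻¹ • γ • z).im = y}

/-- **The invariant height** `y_Γ(z) = max_i max_{γ ∈ Γ} Im σ_i⁻¹γz` (2.42) (a supremum; it is a
maximum by `exists_isGreatest_heightSet`, and `0` when there is no cusp). [cite: Iwaniec2002, §2.6 (2.42), PDF p. 39] -/
def invHeight (Γ : Subgroup (GL (Fin 2) ℝ)) (σ : Fin h → SL(2, ℝ)) (z : ℍ) : ℝ := sSup (heightSet Γ σ z)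

/-- Membership in the height set. [folklore] -/
theorem mem_heightSet_iff {z : ℍ} {y : ℝ} : y ∈ heightSet Γ σ z ↔
    ∃ i, ∃ γ ∈ Γ, ((Matrix.SpecialLinearGroup.toGL (σ i) : GL (Fin 2) ℝ)⁻¹ • γ • z).im = y := Iff.rfl

/-- The frame heights `Im σ_i⁻¹ z` belong to the height set. [folklore] -/
theorem im_frame_mem_heightSet (i : Fin h) (z : ℍ) :
    ((Matrix.SpecialLinearGroup.toGL (σ i) : GL (Fin 2) ℝ)⁻¹ • z).im ∈ heightSet Γ σ z :=
  ⟨i, 1, Γ.one_mem, by rw [one_smul]⟩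

/-- The height set is nonempty as soon as there is a cusp. [folklore] -/
theorem heightSet_nonempty (i : Fin h) (z : ℍ) : (heightSet Γ σ z).Nonempty :=
  ⟨_, im_frame_mem_heightSet i z⟩

/-- Heights are positive. [folklore] -/
theorem pos_of_mem_heightSet {z : ℍ} {y : ℝ} (hy : y ∈ heightSet Γ σ z) : 0 < y := by
  obtain ⟨i, γ, -, rfl⟩ := hy
  exact UpperHalfPlane.im_pos _

end Defs

/-! ## 2. Finiteness: the maximum is attained -/

section Max

/-- Frame plumbing: the conjugate group `σ⁻¹Γσ` is discrete, lies in `SL₂(ℝ)` and contains `T`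
when the periods are `ℤ`. [folklore] -/
theorem frame_hyps
    (hΓ : Γ ≤ (Matrix.SpecialLinearGroup.toGL : SL(2, ℝ) →* GL (Fin 2) ℝ).range)
    (hd : IsDiscreteSubgroup Γ) (s : SL(2, ℝ))
    (hper : (ConjAct.toConjAct (Matrix.SpecialLinearGroup.toGL s : GL (Fin 2) ℝ)⁻¹ • Γ).strictPeriods =
      AddSubgroup.zmultiples 1) :
    (ConjAct.toConjAct (Matrix.SpecialLinearGroup.toGL s : GL (Fin 2) ℝ)⁻¹ • Γ) ≤
        (Matrix.SpecialLinearGroup.toGL : SL(2, ℝ) →* GL (Fin 2) ℝ).range ∧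
      IsDiscreteSubgroup (ConjAct.toConjAct (Matrix.SpecialLinearGroup.toGL s : GL (Fin 2) ℝ)⁻¹ • Γ) ∧
      Matrix.GeneralLinearGroup.upperRightHom (1 : ℝ) ∈
        ConjAct.toConjAct (Matrix.SpecialLinearGroup.toGL s : GL (Fin 2) ℝ)⁻¹ • Γ := by
  refine ⟨?_, hd.conj _, upperRightHom_one_mem_of_periods hper⟩
  have := conj_le_range hΓ s⁻¹
  rwa [map_inv] at this

/-- The height `Im σ⁻¹γz` is the height of `σ⁻¹γσ ∈ σ⁻¹Γσ` at `σ⁻¹z`. [folklore] -/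
theorem im_frame_smul_eq (s : SL(2, ℝ)) (γ : GL (Fin 2) ℝ) (z : ℍ) :
    ((Matrix.SpecialLinearGroup.toGL s : GL (Fin 2) ℝ)⁻¹ • γ • z).im =
      ((((Matrix.SpecialLinearGroup.toGL s : GL (Fin 2) ℝ)⁻¹ * γ * Matrix.SpecialLinearGroup.toGL s) :
        GL (Fin 2) ℝ) • ((Matrix.SpecialLinearGroup.toGL s : GL (Fin 2) ℝ)⁻¹ • z)).im := by
  rw [mul_smul, mul_smul, smul_inv_smul]

/-- **In each frame the heights are bounded and the maximum over `Γ` is attained** (Lemma 2.10: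
only finitely many rows have height `> Y`). [cite: Iwaniec2002, Lemma 2.10, PDF pp. 38–39] -/
theorem exists_max_frame
    (hΓ : Γ ≤ (Matrix.SpecialLinearGroup.toGL : SL(2, ℝ) →* GL (Fin 2) ℝ).range)
    (hd : IsDiscreteSubgroup Γ) (s : SL(2, ℝ))
    (hper : (ConjAct.toConjAct (Matrix.SpecialLinearGroup.toGL s : GL (Fin 2) ℝ)⁻¹ • Γ).strictPeriods =
      AddSubgroup.zmultiples 1) (z : ℍ) :
    ∃ γ₀ ∈ Γ, ∀ γ ∈ Γ, ((Matrix.SpecialLinearGroup.toGL s : GL (Fin 2) ℝ)⁻¹ • γ • z).im ≤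
      ((Matrix.SpecialLinearGroup.toGL s : GL (Fin 2) ℝ)⁻¹ • γ₀ • z).im := by
  obtain ⟨hΓ', hd', hT'⟩ := frame_hyps hΓ hd s hper
  set S : GL (Fin 2) ℝ := Matrix.SpecialLinearGroup.toGL s with hS
  set Γ' := ConjAct.toConjAct S⁻¹ • Γ with hΓ'def
  obtain ⟨g₀, hg₀, hmax⟩ := exists_smul_maximal hΓ' hd' hT' (S⁻¹ • z)
  -- `g₀ = S⁻¹ γ₀ S` with `γ₀ ∈ Γ`
  have hγ₀ : S * g₀ * S⁻¹ ∈ Γ := (mem_conj_inv_iff S g₀).mp hg₀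
  refine ⟨S * g₀ * S⁻¹, hγ₀, fun γ hγ => ?_⟩
  have e₀ : S⁻¹ • (S * g₀ * S⁻¹) • z = g₀ • S⁻¹ • z := by
    simp only [smul_smul]
    congr 1
    group
  rw [e₀]
  -- `S⁻¹γ = (S⁻¹γS g₀⁻¹) g₀ S⁻¹`, and the height of the first factor at `g₀ S⁻¹ z` is a row height
  have hgmem : S⁻¹ * γ * S ∈ Γ' := conj_mem_conj_inv hγ S
  have hmem' : S⁻¹ * γ * S * g₀⁻¹ ∈ Γ' := Γ'.mul_mem hgmem (Γ'.inv_mem hg₀)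
  have e1 : S⁻¹ • γ • z = (S⁻¹ * γ * S * g₀⁻¹) • g₀ • S⁻¹ • z := by
    simp only [smul_smul]
    congr 1
    group
  rw [e1, im_smul_eq_rowIm (hΓ' hmem')]
  exact hmax _ (row_mem_rows hmem')

/-- **The invariant height is a maximum**: for `h ≥ 1` the height set has a greatest element.
[cite: Iwaniec2002, §2.6 (2.42), PDF p. 39] -/
theorem exists_isGreatest_heightSet
    (hΓ : Γ ≤ (Matrix.SpecialLinearGroup.toGL : SL(2, ℝ) →* GL (Fin 2) ℝ).range)
    (hd : IsDiscreteSubgroup Γ)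
    (hper : ∀ i, (ConjAct.toConjAct (Matrix.SpecialLinearGroup.toGL (σ i) : GL (Fin 2) ℝ)⁻¹ • Γ).strictPeriods =
      AddSubgroup.zmultiples 1)
    (i₀ : Fin h) (z : ℍ) : ∃ y, IsGreatest (heightSet Γ σ z) y := by
  classical
  choose γ₀ hγ₀ hmax using fun i => exists_max_frame hΓ hd (σ i) (hper i) z
  set M : Fin h → ℝ := fun i => ((Matrix.SpecialLinearGroup.toGL (σ i) : GL (Fin 2) ℝ)⁻¹ • γ₀ i • z).im with hM
  obtain ⟨i₁, -, hi₁⟩ := Finset.univ.exists_max_image M ⟨i₀, Finset.mem_univ _⟩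
  refine ⟨M i₁, ⟨i₁, γ₀ i₁, hγ₀ i₁, rfl⟩, ?_⟩
  rintro y ⟨i, γ, hγ, rfl⟩
  exact (hmax i γ hγ).trans (hi₁ i (Finset.mem_univ _))

/-- The height set is bounded above. [folklore] -/
theorem bddAbove_heightSet
    (hΓ : Γ ≤ (Matrix.SpecialLinearGroup.toGL : SL(2, ℝ) →* GL (Fin 2) ℝ).range)
    (hd : IsDiscreteSubgroup Γ)
    (hper : ∀ i, (ConjAct.toConjAct (Matrix.SpecialLinearGroup.toGL (σ i) : GL (Fin 2) ℝ)⁻¹ • Γ).strictPeriods =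
      AddSubgroup.zmultiples 1) (z : ℍ) : BddAbove (heightSet Γ σ z) := by
  rcases isEmpty_or_nonempty (Fin h) with hh | ⟨⟨i₀⟩⟩
  · refine ⟨0, ?_⟩
    rintro y ⟨i, -⟩
    exact (hh.false i).elim
  · obtain ⟨y, hy⟩ := exists_isGreatest_heightSet hΓ hd hper i₀ z
    exact hy.bddAbove

/-- Every height is at most the invariant height. [cite: Iwaniec2002, §2.6 (2.42), PDF p. 39] -/
theorem le_invHeight
    (hΓ : Γ ≤ (Matrix.SpecialLinearGroup.toGL : SL(2, ℝ) →* GL (Fin 2) ℝ).range)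
    (hd : IsDiscreteSubgroup Γ)
    (hper : ∀ i, (ConjAct.toConjAct (Matrix.SpecialLinearGroup.toGL (σ i) : GL (Fin 2) ℝ)⁻¹ • Γ).strictPeriods =
      AddSubgroup.zmultiples 1) {z : ℍ} {y : ℝ} (hy : y ∈ heightSet Γ σ z) : y ≤ invHeight Γ σ z :=
  le_csSup (bddAbove_heightSet hΓ hd hper z) hy

/-- In particular `Im σ_i⁻¹ γ z ≤ y_Γ(z)`. [cite: Iwaniec2002, §2.6 (2.42), PDF p. 39] -/
theorem im_frame_smul_le_invHeight
    (hΓ : Γ ≤ (Matrix.SpecialLinearGroup.toGL : SL(2, ℝ) →* GL (Fin 2) ℝ).range)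
    (hd : IsDiscreteSubgroup Γ)
    (hper : ∀ i, (ConjAct.toConjAct (Matrix.SpecialLinearGroup.toGL (σ i) : GL (Fin 2) ℝ)⁻¹ • Γ).strictPeriods =
      AddSubgroup.zmultiples 1) (i : Fin h) {γ : GL (Fin 2) ℝ} (hγ : γ ∈ Γ) (z : ℍ) :
    ((Matrix.SpecialLinearGroup.toGL (σ i) : GL (Fin 2) ℝ)⁻¹ • γ • z).im ≤ invHeight Γ σ z :=
  le_invHeight hΓ hd hper ⟨i, γ, hγ, rfl⟩

/-- The frame heights are at most the invariant height: `Im σ_i⁻¹ z ≤ y_Γ(z)`. [cite: Iwaniec2002, §2.6 (2.42), PDF p. 39] -/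
theorem im_frame_le_invHeight
    (hΓ : Γ ≤ (Matrix.SpecialLinearGroup.toGL : SL(2, ℝ) →* GL (Fin 2) ℝ).range)
    (hd : IsDiscreteSubgroup Γ)
    (hper : ∀ i, (ConjAct.toConjAct (Matrix.SpecialLinearGroup.toGL (σ i) : GL (Fin 2) ℝ)⁻¹ • Γ).strictPeriods =
      AddSubgroup.zmultiples 1) (i : Fin h) (z : ℍ) :
    ((Matrix.SpecialLinearGroup.toGL (σ i) : GL (Fin 2) ℝ)⁻¹ • z).im ≤ invHeight Γ σ z :=
  le_invHeight hΓ hd hper (im_frame_mem_heightSet i z)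

/-- The invariant height is attained: `y_Γ(z) = Im σ_i⁻¹γ₀z` for some `i`, `γ₀ ∈ Γ` (`h ≥ 1`).
[cite: Iwaniec2002, §2.6 (2.42), PDF p. 39] -/
theorem exists_invHeight_eq
    (hΓ : Γ ≤ (Matrix.SpecialLinearGroup.toGL : SL(2, ℝ) →* GL (Fin 2) ℝ).range)
    (hd : IsDiscreteSubgroup Γ)
    (hper : ∀ i, (ConjAct.toConjAct (Matrix.SpecialLinearGroup.toGL (σ i) : GL (Fin 2) ℝ)⁻¹ • Γ).strictPeriods =
      AddSubgroup.zmultiples 1) (i₀ : Fin h) (z : ℍ) :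
    ∃ i, ∃ γ ∈ Γ, invHeight Γ σ z = ((Matrix.SpecialLinearGroup.toGL (σ i) : GL (Fin 2) ℝ)⁻¹ • γ • z).im := by
  obtain ⟨y, hy⟩ := exists_isGreatest_heightSet hΓ hd hper i₀ z
  obtain ⟨i, γ, hγ, rfl⟩ := hy.1
  exact ⟨i, γ, hγ, hy.csSup_eq⟩

/-- The invariant height is positive (`h ≥ 1`). [cite: Iwaniec2002, §2.6 (2.43), PDF p. 40] -/
theorem invHeight_pos
    (hΓ : Γ ≤ (Matrix.SpecialLinearGroup.toGL : SL(2, ℝ) →* GL (Fin 2) ℝ).range)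
    (hd : IsDiscreteSubgroup Γ)
    (hper : ∀ i, (ConjAct.toConjAct (Matrix.SpecialLinearGroup.toGL (σ i) : GL (Fin 2) ℝ)⁻¹ • Γ).strictPeriods =
      AddSubgroup.zmultiples 1) (i₀ : Fin h) (z : ℍ) : 0 < invHeight Γ σ z := by
  obtain ⟨i, γ, -, e⟩ := exists_invHeight_eq hΓ hd hper i₀ z
  rw [e]
  exact UpperHalfPlane.im_pos _

/-- Without cusps the invariant height is `0` by convention. [folklore] -/
theorem invHeight_of_isEmpty [IsEmpty (Fin h)] (z : ℍ) : invHeight Γ σ z = 0 := by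
  have : heightSet Γ σ z = ∅ := by
    ext y
    simp only [Set.mem_empty_iff_false, iff_false]
    rintro ⟨i, -⟩
    exact IsEmpty.false i
  rw [invHeight, this, Real.sSup_empty]

end Max

/-! ## 3. Invariance, the height in a cuspidal zone, the lower bound (2.43) and the partition -/

section Properties

/-- The height set is `Γ`-invariant. [cite: Iwaniec2002, §2.6 (2.42), PDF p. 39] -/
theorem heightSet_smul {δ : GL (Fin 2) ℝ} (hδ : δ ∈ Γ) (z : ℍ) : heightSet Γ σ (δ • z) = heightSet Γ σ z := by
  ext y
  constructor
  · rintro ⟨i, γ, hγ, rfl⟩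
    exact ⟨i, γ * δ, Γ.mul_mem hγ hδ, by rw [mul_smul]⟩
  · rintro ⟨i, γ, hγ, rfl⟩
    exact ⟨i, γ * δ⁻¹, Γ.mul_mem hγ (Γ.inv_mem hδ), by rw [mul_smul, inv_smul_smul]⟩

/-- **`Γ`-invariance of the invariant height**: `y_Γ(δz) = y_Γ(z)` for `δ ∈ Γ`.
[cite: Iwaniec2002, §2.6 (2.42), PDF p. 39] -/
theorem invHeight_smul {δ : GL (Fin 2) ℝ} (hδ : δ ∈ Γ) (z : ℍ) : invHeight Γ σ (δ • z) = invHeight Γ σ z := by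
  rw [invHeight, invHeight, heightSet_smul hδ]

/-- Normalising the real part: `T_{-⌊Re u⌋} u ∈ P(Y)` for `Im u > Y`, with `σ T_{-n} σ⁻¹ ∈ Γ` when the
periods of `σ⁻¹Γσ` are `ℤ`. [cite: Iwaniec2002, §2.2 (2.1)–(2.2), PDF p. 30] -/
theorem exists_smul_eq_frame_cuspStrip {s : SL(2, ℝ)}
    (hper : (ConjAct.toConjAct (Matrix.SpecialLinearGroup.toGL s : GL (Fin 2) ℝ)⁻¹ • Γ).strictPeriods =
      AddSubgroup.zmultiples 1) {u : ℍ} {Y : ℝ} (hu : Y < u.im) :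
    ∃ γ ∈ Γ, ∃ u' ∈ cuspStrip Y, u'.im = u.im ∧
      γ • ((Matrix.SpecialLinearGroup.toGL s : GL (Fin 2) ℝ) • u) =
        (Matrix.SpecialLinearGroup.toGL s : GL (Fin 2) ℝ) • u' := by
  set S : GL (Fin 2) ℝ := Matrix.SpecialLinearGroup.toGL s with hS
  set n : ℤ := ⌊u.re⌋ with hn
  set T' : GL (Fin 2) ℝ := Matrix.GeneralLinearGroup.upperRightHom (-(n : ℝ)) with hT'
  have hT'mem : T' ∈ ConjAct.toConjAct S⁻¹ • Γ := by
    rw [hT', ← Subgroup.mem_strictPeriods_iff, hper, AddSubgroup.mem_zmultiples_iff]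
    exact ⟨-n, by simp⟩
  have hγ : S * T' * S⁻¹ ∈ Γ := (mem_conj_inv_iff S T').mp hT'mem
  refine ⟨S * T' * S⁻¹, hγ, ((-(n : ℝ)) +ᵥ u), ?_, ?_, ?_⟩
  · refine ⟨?_, ?_, ?_⟩
    · rw [UpperHalfPlane.vadd_re]; have := Int.floor_le u.re; linarith
    · rw [UpperHalfPlane.vadd_re]; have := Int.lt_floor_add_one u.re; linarith
    · rw [UpperHalfPlane.vadd_im]; exact hu
  · rw [UpperHalfPlane.vadd_im]
  · rw [mul_smul, mul_smul, inv_smul_smul, hT', upperRightHom_smul]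

/-- **The invariant height in a cuspidal zone is the frame height**: `y_Γ(σ_i w) = Im w` whenever
`Im w ≥ 1` ("`y_Γ(σ_𝔞 z) = y` if `y` is sufficiently large"; here `y ≥ 1` suffices because the frames
are normalised to width one): an element of `Γ_{𝔞_i}` is `±Tⁿ` in the frame and keeps the height,
and any other element has lower-left entry `|c| ≥ 1` after scaling (the horoballs `σ{Im > 1}` are
precisely invariant), so it maps `w` to height `≤ 1/Im w ≤ Im w`.
[cite: Iwaniec2002, §2.6 (2.42)–(2.43), PDF pp. 39–40] -/
theorem invHeight_frame_smul
    (hΓ : Γ ≤ (Matrix.SpecialLinearGroup.toGL : SL(2, ℝ) →* GL (Fin 2) ℝ).range)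
    (hneg : -1 ∈ Γ) (hd : IsDiscreteSubgroup Γ)
    (hinfty : ∀ i, (Matrix.SpecialLinearGroup.toGL (σ i) : GL (Fin 2) ℝ) • (OnePoint.infty : OnePoint ℝ) = 𝔞 i)
    (hper : ∀ i, (ConjAct.toConjAct (Matrix.SpecialLinearGroup.toGL (σ i) : GL (Fin 2) ℝ)⁻¹ • Γ).strictPeriods =
      AddSubgroup.zmultiples 1)
    (hineq : ∀ i j, ∀ γ ∈ Γ, γ • 𝔞 i = 𝔞 j → i = j) (i : Fin h) {w : ℍ} (hw : 1 ≤ w.im) :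
    invHeight Γ σ ((Matrix.SpecialLinearGroup.toGL (σ i) : GL (Fin 2) ℝ) • w) = w.im := by
  have ee : ∀ (x : SL(2, ℝ)) (z : ℍ), (Matrix.SpecialLinearGroup.toGL x : GL (Fin 2) ℝ) • z = x • z :=
    fun x z => rfl
  set S : Fin h → GL (Fin 2) ℝ := fun j => Matrix.SpecialLinearGroup.toGL (σ j) with hS
  have hgreat : IsGreatest (heightSet Γ σ (S i • w)) w.im := by
    refine ⟨⟨i, 1, Γ.one_mem, by rw [one_smul]; simp [hS]⟩, ?_⟩
    rintro y ⟨j, γ, hγ, rfl⟩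
    by_cases hfix : γ • 𝔞 i = 𝔞 j
    · -- `γ ∈ Γ_{𝔞_i}`, `i = j`: a translation in the frame
      have hij := hineq i j γ hγ hfix
      subst hij
      obtain ⟨n, hn⟩ := conj_eq_upperRightHom_of_smul_eq hΓ hneg hd (hinfty i) (hper i) hγ hfix
      have e : (S i)⁻¹ • γ • S i • w = ((S i)⁻¹ * γ * S i) • w := by simp only [smul_smul, mul_assoc]
      rw [e]
      rcases hn with hn | hn
      · rw [show (S i)⁻¹ * γ * S i = _ from hn, upperRightHom_smul, UpperHalfPlane.vadd_im]
      · rw [show (S i)⁻¹ * γ * S i = _ from hn, UpperHalfPlane.neg_smul, upperRightHom_smul,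
          UpperHalfPlane.vadd_im]
    · -- another cusp: `|c| ≥ 1` for `σ_j⁻¹ γ σ_i`
      obtain ⟨e, he⟩ := hΓ hγ
      have hτ : (Matrix.SpecialLinearGroup.toGL (e * σ i) : GL (Fin 2) ℝ) • (OnePoint.infty : OnePoint ℝ) =
          γ • 𝔞 i := by rw [map_mul, he, mul_smul, hinfty i]
      have hperτ : (ConjAct.toConjAct (Matrix.SpecialLinearGroup.toGL (e * σ i) : GL (Fin 2) ℝ)⁻¹ • Γ).strictPeriods =
          AddSubgroup.zmultiples 1 := by
        rw [map_mul, he, conj_inv_mul]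
        have hnorm : γ⁻¹ ∈ Subgroup.normalizer Γ := Subgroup.le_normalizer (Γ.inv_mem hγ)
        rw [Subgroup.conjAct_pointwise_smul_eq_self hnorm]
        exact hper i
      have hc := one_le_abs_c_of_ne hΓ hd (hinfty j) (hper j) hτ hperτ (Ne.symm hfix)
      have key := im_smul_mul_im_le_one (g := Matrix.SpecialLinearGroup.toGL ((σ j)⁻¹ * (e * σ i))) ⟨_, rfl⟩ hc w
      have eg : (Matrix.SpecialLinearGroup.toGL ((σ j)⁻¹ * (e * σ i)) : GL (Fin 2) ℝ) • w = (S j)⁻¹ • γ • S i • w := by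
        rw [map_mul, map_mul, map_inv, he, mul_smul, mul_smul]
      rw [eg] at key
      have hy : 0 < ((S j)⁻¹ • γ • S i • w).im := UpperHalfPlane.im_pos _
      -- `y · Im w ≤ 1 ≤ (Im w)²`
      nlinarith
  exact hgreat.csSup_eq

/-- **The lower bound (2.43)**: `y_Γ = inf_z y_Γ(z) > 0` — there is `c > 0` with `y_Γ(z) ≥ c` for
all `z` (for a finite volume group with at least one cusp): on the compact core the frame height
`Im σ_1⁻¹z` is bounded below, and in a cuspidal region `σ_i{Im > 1}` the height exceeds `1`.
[cite: Iwaniec2002, §2.6 (2.43), PDF p. 40] -/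
theorem exists_pos_le_invHeight
    (hΓ : Γ ≤ (Matrix.SpecialLinearGroup.toGL : SL(2, ℝ) →* GL (Fin 2) ℝ).range)
    (hneg : -1 ∈ Γ) (hd : IsDiscreteSubgroup Γ) (hF : IsHypFundamentalDomain Γ F) (hvol : volume F < ⊤)
    (hinfty : ∀ i, (Matrix.SpecialLinearGroup.toGL (σ i) : GL (Fin 2) ℝ) • (OnePoint.infty : OnePoint ℝ) = 𝔞 i)
    (hper : ∀ i, (ConjAct.toConjAct (Matrix.SpecialLinearGroup.toGL (σ i) : GL (Fin 2) ℝ)⁻¹ • Γ).strictPeriods =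
      AddSubgroup.zmultiples 1)
    (hcomplete : ∀ c : OnePoint ℝ, IsCusp c Γ → ∃ i, ∃ γ ∈ Γ, γ • 𝔞 i = c) (i₀ : Fin h) :
    ∃ c : ℝ, 0 < c ∧ ∀ z : ℍ, c ≤ invHeight Γ σ z := by
  obtain ⟨K, hK, hcover⟩ := exists_compact_core hΓ hneg hd hF hvol hinfty hper hcomplete
  set S₀ : GL (Fin 2) ℝ := Matrix.SpecialLinearGroup.toGL (σ i₀) with hS₀
  set f : ℍ → ℝ := fun z => (S₀⁻¹ • z).im with hf
  have hfc : Continuous f := UpperHalfPlane.continuous_im.comp (continuous_const_smul _)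
  -- the bound on the compact core
  have hcore : ∃ c₀ : ℝ, 0 < c₀ ∧ ∀ z ∈ K, c₀ ≤ f z := by
    by_cases hKne : K.Nonempty
    · obtain ⟨z₀, hz₀, hmin⟩ := hK.exists_isMinOn hKne hfc.continuousOn
      exact ⟨f z₀, UpperHalfPlane.im_pos _, fun z hz => hmin hz⟩
    · refine ⟨1, one_pos, fun z hz => (hKne ⟨z, hz⟩).elim⟩
  obtain ⟨c₀, hc₀, hc₀K⟩ := hcore
  refine ⟨min c₀ 1, lt_min hc₀ one_pos, fun z => ?_⟩
  obtain ⟨γ, hγ, hγz⟩ := hcover z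
  rw [← invHeight_smul (σ := σ) hγ z]
  rcases hγz with hzK | ⟨i, u, hu, eu⟩
  · calc min c₀ 1 ≤ c₀ := min_le_left _ _
      _ ≤ f (γ • z) := hc₀K _ hzK
      _ ≤ invHeight Γ σ (γ • z) := le_invHeight hΓ hd hper ⟨i₀, 1, Γ.one_mem, by rw [one_smul]⟩
  · have hmem : u.im ∈ heightSet Γ σ (γ • z) := ⟨i, 1, Γ.one_mem, by
      rw [one_smul, ← eu]; exact congrArg UpperHalfPlane.im (inv_smul_smul _ _)⟩
    calc min c₀ 1 ≤ 1 := min_le_right _ _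
      _ ≤ u.im := le_of_lt hu
      _ ≤ invHeight Γ σ (γ • z) := le_invHeight hΓ hd hper hmem

/-- **Points of large invariant height are in a cuspidal zone**: if `y_Γ(z) > Y ≥ 0` then
`γz ∈ σ_i P(Y)` for some `γ ∈ Γ` and `i`. [cite: Iwaniec2002, §2.2 (2.3)–(2.5), PDF pp. 30–31] -/
theorem exists_smul_mem_cuspStrip_of_lt
    (hper : ∀ i, (ConjAct.toConjAct (Matrix.SpecialLinearGroup.toGL (σ i) : GL (Fin 2) ℝ)⁻¹ • Γ).strictPeriods =
      AddSubgroup.zmultiples 1) {Y : ℝ} (hY : 0 ≤ Y) {z : ℍ} (hlt : Y < invHeight Γ σ z) :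
    ∃ γ ∈ Γ, ∃ i, ∃ u ∈ cuspStrip Y, (Matrix.SpecialLinearGroup.toGL (σ i) : GL (Fin 2) ℝ) • u = γ • z := by
  have hne : (heightSet Γ σ z).Nonempty := by
    by_contra hemp
    rw [Set.not_nonempty_iff_eq_empty] at hemp
    rw [invHeight, hemp, Real.sSup_empty] at hlt
    linarith
  obtain ⟨y, ⟨i, γ, hγ, rfl⟩, hYy⟩ := exists_lt_of_lt_csSup hne hlt
  set S : GL (Fin 2) ℝ := Matrix.SpecialLinearGroup.toGL (σ i) with hS
  obtain ⟨γ', hγ', u', hu', -, e⟩ := exists_smul_eq_frame_cuspStrip (s := σ i) (hper i) hYy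
  refine ⟨γ' * γ, Γ.mul_mem hγ' hγ, i, u', hu', ?_⟩
  rw [mul_smul, ← e, smul_inv_smul]

/-- A compact box `σ{0 ≤ Re ≤ 1, 1 ≤ Im ≤ Y}`-shaped set containing the normalised points of
height in `(1, Y]`. [folklore] -/
theorem exists_compact_box (Y : ℝ) :
    ∃ B : Set ℍ, IsCompact B ∧ ∀ u : ℍ, 0 ≤ u.re → u.re ≤ 1 → 1 ≤ u.im → u.im ≤ Y → u ∈ B := by
  set Fm : ℝ × ℝ → ℍ := fun p => ⟨(p.1 : ℂ) + (max p.2 1 : ℝ) * Complex.I, by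
    simp only [Complex.add_im, Complex.ofReal_im, Complex.mul_im, Complex.ofReal_re, Complex.I_im, mul_one,
      Complex.I_re, mul_zero, add_zero, zero_add]
    positivity⟩ with hFm
  have hFc : Continuous Fm := by
    rw [UpperHalfPlane.isEmbedding_coe.continuous_iff]
    show Continuous (fun p : ℝ × ℝ => ((p.1 : ℂ) + ((max p.2 1 : ℝ) : ℂ) * Complex.I))
    fun_prop
  refine ⟨Fm '' (Icc 0 1 ×ˢ Icc 1 Y), (isCompact_Icc.prod isCompact_Icc).image hFc, ?_⟩
  intro u h0 h1 h2 h3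
  refine ⟨(u.re, u.im), ⟨⟨h0, h1⟩, ⟨h2, h3⟩⟩, ?_⟩
  apply UpperHalfPlane.ext
  show ((u.re : ℂ) + ((max u.im 1 : ℝ) : ℂ) * Complex.I) = (u : ℂ)
  rw [max_eq_left h2]
  apply Complex.ext <;> simp

/-- **Points of bounded invariant height are `Γ`-equivalent to a fixed compact set** ((2.5): the
central part `F(Y)` has compact closure): for `Y ≥ 1` there is a compact `K_Y` with
`{z : y_Γ(z) ≤ Y} ⊆ Γ K_Y`. [cite: Iwaniec2002, §2.2 (2.5) & Prop. 2.3, PDF pp. 28–31] -/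
theorem exists_compact_of_invHeight_le
    (hΓ : Γ ≤ (Matrix.SpecialLinearGroup.toGL : SL(2, ℝ) →* GL (Fin 2) ℝ).range)
    (hneg : -1 ∈ Γ) (hd : IsDiscreteSubgroup Γ) (hF : IsHypFundamentalDomain Γ F) (hvol : volume F < ⊤)
    (hinfty : ∀ i, (Matrix.SpecialLinearGroup.toGL (σ i) : GL (Fin 2) ℝ) • (OnePoint.infty : OnePoint ℝ) = 𝔞 i)
    (hper : ∀ i, (ConjAct.toConjAct (Matrix.SpecialLinearGroup.toGL (σ i) : GL (Fin 2) ℝ)⁻¹ • Γ).strictPeriods =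
      AddSubgroup.zmultiples 1)
    (hcomplete : ∀ c : OnePoint ℝ, IsCusp c Γ → ∃ i, ∃ γ ∈ Γ, γ • 𝔞 i = c) (Y : ℝ) :
    ∃ K : Set ℍ, IsCompact K ∧ ∀ z : ℍ, invHeight Γ σ z ≤ Y → ∃ γ ∈ Γ, γ • z ∈ K := by
  obtain ⟨K, hK, hcover⟩ := exists_compact_core hΓ hneg hd hF hvol hinfty hper hcomplete
  obtain ⟨B, hB, hBmem⟩ := exists_compact_box Y
  refine ⟨K ∪ ⋃ i, (Matrix.SpecialLinearGroup.toGL (σ i) : GL (Fin 2) ℝ) • B, ?_, ?_⟩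
  · exact hK.union (isCompact_iUnion fun i => hB.smul _)
  intro z hz
  obtain ⟨γ, hγ, hγz⟩ := hcover z
  rcases hγz with hzK | ⟨i, u, hu, eu⟩
  · exact ⟨γ, hγ, Or.inl hzK⟩
  · -- `γ z = σ_i u`, `1 < Im u ≤ Y`; normalise the real part
    have hu' : (1 : ℝ) < u.im := hu
    obtain ⟨γ', hγ', u', ⟨h0, h1, -⟩, hui, e⟩ := exists_smul_eq_frame_cuspStrip (s := σ i) (hper i) hu'
    have huY : u.im ≤ Y := by
      have hmem : u.im ∈ heightSet Γ σ (γ • z) := ⟨i, 1, Γ.one_mem, by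
        rw [one_smul, ← eu]; exact congrArg UpperHalfPlane.im (inv_smul_smul _ _)⟩
      have := le_invHeight hΓ hd hper hmem
      rw [invHeight_smul hγ] at this
      exact this.trans hz
    refine ⟨γ' * γ, Γ.mul_mem hγ' hγ, Or.inr (Set.mem_iUnion.mpr ⟨i, ⟨u', ?_, ?_⟩⟩)⟩
    · exact hBmem u' h0 h1.le (by rw [hui]; exact hu'.le) (by rw [hui]; exact huY)
    · show (Matrix.SpecialLinearGroup.toGL (σ i) : GL (Fin 2) ℝ) • u' = (γ' * γ) • z
      rw [mul_smul, ← eu, e]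

end Properties

end Fuchsian

end Literature.NumberTheory.Automorphic

end
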